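import Literature.Computability.QuantumComplexity.GRMassTable
import Literature.Computability.QuantumComplexity.HidingProgram
import HarnessLib

/-!
# The clamped mass table of the Grover–Rudolph cosine machine

Topic `Literature/Computability/QuantumComplexity`; sequel of `GRMassTable.lean`. There the table
`tableT S p U ℓ` of signed Gaussian integrals `G(π/S, x)` at the dyadic endpoints `|x| ≤ 2^ℓ` is
`2/2^p`-accurate under the budget hypothesis `4·4^ℓ ≤ U·S` of the Taylor evaluator `gaussFApprox`
(`U` is UNARY on the machine's parameter wires, so it must stay polynomial). In Regev's sampler
(Lemma 3.12, proof; §2 p. 11 "to within `2^{-poly}`") the ratio `2^ℓ/D_t` of the box register to the grid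
scale varies by `2^{poly}` across instances of one input length, so that hypothesis would force an
exponential `U`. The standard remedy is to CLAMP the argument: beyond `u₀ ≈ √(U·S)/2` the Gaussian
integral is within `e^{-πu₀²/S} ≤ e^{-U/6}` of its value at `u₀`, so evaluating at `min(|x|, u₀)` costs
nothing in accuracy once `U ≥ 6(p + ℓ + 3)` — a budget INDEPENDENT of `S`:

* `clampN S U = ⌊√(U·|num S|/(4·den S))⌋` (natural arithmetic only); the clamp `clampZ u₀ x ∈ [−u₀, u₀]` is the one of
  `HidingProgram.lean` (`clampZ`, `abs_clampZ_le`, `clampZ_of_abs_le`);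
* `sGc S p U x = sG S (p+1) U (clampZ (clampN S U) x)` and **`abs_gaussF_sub_sGc_le`**:
  `|G(π/S, x) − sGc x| ≤ 2^{-p}` for `1 ≤ S`, `6(p + ℓ + 3) ≤ U`, `|x| ≤ 2^ℓ`;
* `tableTc S p U ℓ j h = sGc(hi) − sGc(lo)` and **`accurate_tableTc`**: the clamped table is
  `2/2^p`-accurate (`GaussianCells.Accurate`) under `1 ≤ S` and `6(p + ℓ + 3) ≤ U` — the same accuracy
  as `accurate_tableT`, with the `S`-free budget.

Everything here is proved; no named fact is introduced.

## References

* O. Regev, *On lattices, learning with errors, random linear codes, and cryptography*, J. ACM 56 (2009),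
  art. 34, Lemma 3.12 (proof), §2 p. 11 [Regev2009].
* M. Abramowitz, I. Stegun, *Handbook of Mathematical Functions*, 1964, 7.1.5, 7.1.13 (tail of the error
  function) [AbramowitzStegun1964].
-/

noncomputable section

namespace Literature.Computability.QuantumComplexity

open Real Finset GaussianCells Literature.Computability.Complexity.GaussIntegral

namespace GRMassTable

/-! ### Tail of the Gaussian integral -/

/-- **`G(c, b) − G(c, a) ≤ (b − a)·e^{-ca²}`** for `0 ≤ a ≤ b`, `0 ≤ c` (the integrand is decreasing on
`[a, b]`). [cite: AbramowitzStegun1964, 7.1.13] -/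
theorem gaussF_sub_le_mul_exp {c a b : ℝ} (hc : 0 ≤ c) (ha : 0 ≤ a) (hab : a ≤ b) :
    gaussF c b - gaussF c a ≤ (b - a) * Real.exp (-(c * a ^ 2)) := by
  rw [gaussF_sub]
  have h := intervalIntegral.integral_mono_on hab (intervalIntegrable_integrand c a b)
    (intervalIntegrable_const (c := Real.exp (-(c * a ^ 2))) (μ := MeasureTheory.volume) (a := a) (b := b))
    (fun t ht => by
      apply Real.exp_le_exp.2
      have h1 : a ^ 2 ≤ t ^ 2 := pow_le_pow_left₀ ha ht.1 2
      nlinarith)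
  rwa [intervalIntegral.integral_const, smul_eq_mul] at h

/-- `0 ≤ G(c, b) − G(c, a)` for `a ≤ b`. [folklore] -/
theorem gaussF_sub_nonneg (c : ℝ) {a b : ℝ} (hab : a ≤ b) : 0 ≤ gaussF c b - gaussF c a :=
  sub_nonneg.2 (gaussF_mono c hab)

/-! ### The clamp (`clampZ` of `HidingProgram.lean`) -/

/-- Above `u₀` the clamp is `u₀`. [folklore] -/
theorem clampZ_of_lt {u₀ : ℕ} {x : ℤ} (h : (u₀ : ℤ) < x) : clampZ u₀ x = u₀ := by
  unfold clampZ; rw [min_eq_left h.le, max_eq_right (by omega)]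

/-- The clamp is odd. [folklore] -/
theorem clampZ_neg (u₀ : ℕ) (x : ℤ) : clampZ u₀ (-x) = -clampZ u₀ x := by
  simp only [clampZ, max_def, min_def]
  split_ifs <;> omega

/-- **The clamp costs at most the tail**: `|G(c, x) − G(c, clamp x)| ≤ |x|·e^{-cu₀²}` (`0 ≤ c`).
[cite: AbramowitzStegun1964, 7.1.13] -/
theorem abs_gaussF_sub_gaussF_clampZ_le {c : ℝ} (hc : 0 ≤ c) (u₀ : ℕ) :
    ∀ x : ℤ, |gaussF c x - gaussF c (clampZ u₀ x)| ≤ |(x : ℝ)| * Real.exp (-(c * (u₀ : ℝ) ^ 2)) := by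
  -- the nonnegative case
  have pos : ∀ x : ℤ, 0 ≤ x → |gaussF c x - gaussF c (clampZ u₀ x)| ≤ |(x : ℝ)| * Real.exp (-(c * (u₀ : ℝ) ^ 2)) := by
    intro x hx
    rcases le_or_gt x u₀ with h | h
    · rw [clampZ_of_abs_le (abs_le.2 ⟨by omega, h⟩), sub_self, abs_zero]; positivity
    · rw [clampZ_of_lt h, Int.cast_natCast]
      have hle : (u₀ : ℝ) ≤ x := by exact_mod_cast h.le
      rw [abs_of_nonneg (gaussF_sub_nonneg c hle)]
      refine (gaussF_sub_le_mul_exp hc (Nat.cast_nonneg u₀) hle).trans ?_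
      refine mul_le_mul_of_nonneg_right ?_ (Real.exp_pos _).le
      have : (0 : ℝ) ≤ x := by exact_mod_cast hx
      rw [abs_of_nonneg this]; linarith [Nat.cast_nonneg (α := ℝ) u₀]
  intro x
  rcases le_or_gt 0 x with hx | hx
  · exact pos x hx
  · have h := pos (-x) (by omega)
    rw [clampZ_neg, Int.cast_neg, Int.cast_neg, gaussF_neg, gaussF_neg, ← neg_sub', abs_neg, abs_neg] at h
    rwa [← neg_sub, abs_neg, abs_sub_comm]

/-! ### The clamp point -/

/-- **The clamp point** `u₀ = ⌊√(U·|num S| / (4·den S))⌋` — natural arithmetic on the code of `S`.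
[cite: Regev2009, §2 p. 11] -/
def clampN (S : ℚ) (U : ℕ) : ℕ := Nat.sqrt (U * S.num.natAbs / (4 * S.den))

/-- `S = |num S| / den S` as reals for `0 ≤ S`. [folklore] -/
theorem cast_eq_natAbs_div_den {S : ℚ} (hS : 0 ≤ S) : (S : ℝ) = (S.num.natAbs : ℝ) / (S.den : ℝ) := by
  have hn : ((S.num.natAbs : ℤ) : ℝ) = (S.num : ℝ) := by
    rw [Int.natAbs_of_nonneg (Rat.num_nonneg.2 hS)]
  rw [Int.cast_natCast] at hn
  rw [hn, ← Rat.cast_intCast, ← Rat.cast_natCast, ← Rat.cast_div, Rat.num_div_den]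

/-- **The clamp point is inside the Taylor budget**: `4u₀² ≤ U·S` (`0 ≤ S`). [folklore] -/
theorem four_mul_clampN_sq_le {S : ℚ} (hS : 0 ≤ S) (U : ℕ) : 4 * ((clampN S U : ℕ) : ℝ) ^ 2 ≤ U * (S : ℝ) := by
  set N : ℕ := U * S.num.natAbs / (4 * S.den) with hN
  have h1 : ((clampN S U : ℕ) : ℝ) ^ 2 ≤ N := by
    rw [clampN, ← hN]; exact_mod_cast Nat.sqrt_le' N
  have hden : (0 : ℝ) < S.den := by exact_mod_cast S.den_pos
  have h2 : (N : ℝ) * (4 * S.den) ≤ U * S.num.natAbs := by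
    exact_mod_cast Nat.div_mul_le_self (U * S.num.natAbs) (4 * S.den)
  rw [cast_eq_natAbs_div_den hS, mul_div_assoc', le_div_iff₀ hden]
  nlinarith

/-- **The clamp point is far in units of the grid**: `U·S/16 ≤ u₀²` for `1 ≤ S`, `16 ≤ U`. [folklore] -/
theorem clampN_sq_ge {S : ℚ} (hS : 1 ≤ S) {U : ℕ} (hU : 16 ≤ U) : (U : ℝ) * S / 16 ≤ ((clampN S U : ℕ) : ℝ) ^ 2 := by
  set N : ℕ := U * S.num.natAbs / (4 * S.den) with hN
  set u₀ : ℕ := clampN S U with hu₀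
  have hS0 : (0 : ℚ) ≤ S := zero_le_one.trans hS
  have hden : (0 : ℝ) < S.den := by exact_mod_cast S.den_pos
  -- `(u₀ + 1)² ≥ N + 1 > U S / 4`
  have h1 : (N : ℝ) + 1 ≤ ((u₀ : ℝ) + 1) ^ 2 := by
    have h : N + 1 ≤ (u₀ + 1) ^ 2 := Nat.lt_succ_sqrt' N
    exact_mod_cast h
  have h2 : (U : ℝ) * S.num.natAbs < ((N : ℝ) + 1) * (4 * S.den) := by
    have hd := Nat.lt_div_mul_add (a := U * S.num.natAbs) (show 0 < 4 * S.den by positivity)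
    rw [← hN] at hd
    have : U * S.num.natAbs < (N + 1) * (4 * S.den) := by linarith
    exact_mod_cast this
  have h3 : (U : ℝ) * S / 4 < ((u₀ : ℝ) + 1) ^ 2 := by
    rw [cast_eq_natAbs_div_den hS0, mul_div_assoc', div_div, div_lt_iff₀ (by positivity)]
    calc (U : ℝ) * S.num.natAbs < ((N : ℝ) + 1) * (4 * S.den) := h2
      _ ≤ ((u₀ : ℝ) + 1) ^ 2 * (4 * S.den) := mul_le_mul_of_nonneg_right h1 (by positivity)
      _ = ((u₀ : ℝ) + 1) ^ 2 * (S.den * 4) := by ring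
  -- `s = √(U S) ≥ 4`, `s/2 < u₀ + 1`, so `s/4 ≤ u₀`
  set s : ℝ := Real.sqrt (U * S) with hs
  have hUS : (16 : ℝ) ≤ U * S := by
    have hU' : (16 : ℝ) ≤ U := by exact_mod_cast hU
    have hS' : (1 : ℝ) ≤ S := by exact_mod_cast hS
    nlinarith
  have hs2 : s ^ 2 = U * S := Real.sq_sqrt (by linarith)
  have hs4 : 4 ≤ s := by
    rw [hs, show (4 : ℝ) = Real.sqrt (4 ^ 2) by rw [Real.sqrt_sq (by norm_num : (0:ℝ) ≤ 4)]]
    exact Real.sqrt_le_sqrt (by linarith)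
  have h4 : s / 2 < (u₀ : ℝ) + 1 := by
    have h : (s / 2) ^ 2 < ((u₀ : ℝ) + 1) ^ 2 := by rw [div_pow, hs2]; linarith
    exact lt_of_pow_lt_pow_left₀ 2 (by positivity) h
  have h5 : s / 4 ≤ (u₀ : ℝ) := by linarith
  calc (U : ℝ) * S / 16 = (s / 4) ^ 2 := by rw [div_pow, hs2]; ring
    _ ≤ (u₀ : ℝ) ^ 2 := pow_le_pow_left₀ (by positivity) h5 2

/-- **The tail at the clamp point is below `2^{-(p+ℓ+3)}`** for `1 ≤ S` and `6(p+ℓ+3) ≤ U`: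
`e^{-πu₀²/S} ≤ e^{-U/6} ≤ 2^{-(p+ℓ+3)}`. [cite: AbramowitzStegun1964, 7.1.13] -/
theorem exp_clamp_le {S : ℚ} (hS : 1 ≤ S) {p ℓ U : ℕ} (hU : 6 * (p + ℓ + 3) ≤ U) :
    Real.exp (-(Real.pi / S * ((clampN S U : ℕ) : ℝ) ^ 2)) ≤ ((2 : ℝ) ^ (p + ℓ + 3))⁻¹ := by
  have hU16 : 16 ≤ U := by omega
  have hS0 : (0 : ℝ) < S := by exact_mod_cast (lt_of_lt_of_le one_pos hS)
  have hsq := clampN_sq_ge hS hU16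
  have hk : ((p + ℓ + 3 : ℕ) : ℝ) ≤ Real.pi / S * ((clampN S U : ℕ) : ℝ) ^ 2 := by
    have hU' : (6 : ℝ) * (p + ℓ + 3 : ℕ) ≤ U := by exact_mod_cast hU
    calc ((p + ℓ + 3 : ℕ) : ℝ) ≤ (U : ℝ) / 6 := by linarith
      _ ≤ Real.pi / 16 * U := by nlinarith [Real.pi_gt_three, Nat.cast_nonneg (α := ℝ) U]
      _ = Real.pi / S * (U * S / 16) := by field_simp
      _ ≤ Real.pi / S * ((clampN S U : ℕ) : ℝ) ^ 2 := mul_le_mul_of_nonneg_left hsq (by positivity)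
  calc Real.exp (-(Real.pi / S * ((clampN S U : ℕ) : ℝ) ^ 2)) ≤ Real.exp (-((p + ℓ + 3 : ℕ) : ℝ)) :=
        Real.exp_le_exp.2 (neg_le_neg hk)
    _ = (Real.exp ((p + ℓ + 3 : ℕ) : ℝ))⁻¹ := Real.exp_neg _
    _ ≤ ((2 : ℝ) ^ (p + ℓ + 3))⁻¹ := by
        refine inv_anti₀ (by positivity) ?_
        -- `2ⁿ ≤ eⁿ`
        rw [show ((p + ℓ + 3 : ℕ) : ℝ) = (p + ℓ + 3 : ℕ) * 1 by ring, Real.exp_nat_mul]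
        exact pow_le_pow_left₀ (by norm_num) (by have := Real.add_one_le_exp (1 : ℝ); norm_num at this ⊢; exact this) _

/-! ### The clamped signed approximation -/

variable (S : ℚ) (p U : ℕ)

/-- **The clamped signed approximation** of `G(π/S, x)`: the evaluator of `GRMassTable.sG` at precision
`p + 1` on the clamped argument. [cite: Regev2009, §2 p. 11] -/
def sGc (x : ℤ) : ℚ := sG S (p + 1) U (clampZ (clampN S U) x)

variable {S p U}

/-- **Accuracy of the clamped approximation**: `|G(π/S, x) − sGc x| ≤ 2^{−p}` for `1 ≤ S`,
`6(p + ℓ + 3) ≤ U` and `|x| ≤ 2^ℓ` (tail `≤ 2^{-(p+3)}` plus Taylor error `2^{-(p+1)}`).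
[cite: Regev2009, §2 p. 11] [cite: AbramowitzStegun1964, 7.1.5, 7.1.13] -/
theorem abs_gaussF_sub_sGc_le (hS : 1 ≤ S) {ℓ : ℕ} (hU : 6 * (p + ℓ + 3) ≤ U) {x : ℤ} (hx : |(x : ℝ)| ≤ (2 : ℝ) ^ ℓ) :
    |gaussF (Real.pi / S) x - (sGc S p U x : ℝ)| ≤ 1 / (2 : ℝ) ^ p := by
  have hS0 : (0 : ℚ) ≤ S := zero_le_one.trans hS
  have hc : 0 ≤ Real.pi / S := by positivity
  set u₀ : ℕ := clampN S U with hu₀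
  -- Taylor error at the clamped point
  have hin : 4 * ((clampZ u₀ x : ℤ) : ℝ) ^ 2 ≤ U * (S : ℝ) := by
    have ha : |((clampZ u₀ x : ℤ) : ℝ)| ≤ (u₀ : ℝ) := by exact_mod_cast abs_clampZ_le u₀ x
    have hsq : ((clampZ u₀ x : ℤ) : ℝ) ^ 2 ≤ (u₀ : ℝ) ^ 2 := by
      rw [← sq_abs]; exact pow_le_pow_left₀ (abs_nonneg _) ha 2
    linarith [four_mul_clampN_sq_le hS0 U]
  have e1 := abs_gaussF_sub_sG_le (p := p + 1) hS hin
  -- tail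
  have e2 := abs_gaussF_sub_gaussF_clampZ_le hc u₀ x
  have e3 : |(x : ℝ)| * Real.exp (-(Real.pi / S * (u₀ : ℝ) ^ 2)) ≤ 1 / (2 : ℝ) ^ (p + 1) := by
    calc |(x : ℝ)| * Real.exp (-(Real.pi / S * (u₀ : ℝ) ^ 2)) ≤ (2 : ℝ) ^ ℓ * ((2 : ℝ) ^ (p + ℓ + 3))⁻¹ :=
          mul_le_mul hx (exp_clamp_le hS hU) (Real.exp_pos _).le (by positivity)
      _ = 1 / (2 : ℝ) ^ (p + 1) * 4⁻¹ := by rw [pow_add, pow_add, pow_succ]; field_simp; ring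
      _ ≤ 1 / (2 : ℝ) ^ (p + 1) := mul_le_of_le_one_right (by positivity) (by norm_num)
  unfold sGc
  rw [show gaussF (Real.pi / S) x - (sG S (p + 1) U (clampZ u₀ x) : ℝ) =
    (gaussF (Real.pi / S) x - gaussF (Real.pi / S) (clampZ u₀ x)) +
      (gaussF (Real.pi / S) (clampZ u₀ x) - (sG S (p + 1) U (clampZ u₀ x) : ℝ)) by ring]
  calc |(gaussF (Real.pi / S) x - gaussF (Real.pi / S) (clampZ u₀ x)) +
          (gaussF (Real.pi / S) (clampZ u₀ x) - (sG S (p + 1) U (clampZ u₀ x) : ℝ))|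
      ≤ |gaussF (Real.pi / S) x - gaussF (Real.pi / S) (clampZ u₀ x)| +
          |gaussF (Real.pi / S) (clampZ u₀ x) - (sG S (p + 1) U (clampZ u₀ x) : ℝ)| := abs_add_le _ _
    _ ≤ 1 / (2 : ℝ) ^ (p + 1) + 1 / (2 : ℝ) ^ (p + 1) := add_le_add (e2.trans e3) e1
    _ = 1 / (2 : ℝ) ^ p := by rw [pow_succ]; field_simp; norm_num

/-! ### The clamped table -/

variable (S p U)

/-- **The clamped mass table**: `T j h = sGc(hi) − sGc(lo)`. [cite: Regev2009, Lemma 3.12 (proof)] -/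
def tableTc (ℓ j h : ℕ) : ℚ := sGc S p U (hiZ ℓ j h) - sGc S p U (loZ ℓ j h)

variable {S p U}

/-- The endpoints of a prefix satisfy `|x| ≤ 2^ℓ`. [folklore] -/
theorem abs_endpoints_le {ℓ j h : ℕ} (hj : j ≤ ℓ) (hh : h < 2 ^ j) :
    |((loZ ℓ j h : ℤ) : ℝ)| ≤ (2 : ℝ) ^ ℓ ∧ |((hiZ ℓ j h : ℤ) : ℝ)| ≤ (2 : ℝ) ^ ℓ := by
  obtain ⟨hlo, hhi⟩ := endpoints_sq_le hj hh
  have h4 : (4 : ℝ) ^ ℓ = (2 ^ ℓ) ^ 2 := by rw [← pow_mul, mul_comm, pow_mul]; norm_num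
  have key : ∀ z : ℝ, 4 * z ^ 2 ≤ 4 * (4 : ℝ) ^ ℓ → |z| ≤ (2 : ℝ) ^ ℓ := fun z hz => by
    have h : z ^ 2 ≤ ((2 : ℝ) ^ ℓ) ^ 2 := by rw [← h4]; linarith
    have := Real.sqrt_le_sqrt h
    rwa [Real.sqrt_sq_eq_abs, Real.sqrt_sq (by positivity)] at this
  exact ⟨key _ hlo, key _ hhi⟩

/-- **The clamped mass table is `2/2^p`-accurate** (`1 ≤ S`, `6(p + ℓ + 3) ≤ U` — a budget independent
of `S`). [cite: Regev2009, Lemma 3.12 (proof) with §2 p. 11] -/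
theorem accurate_tableTc {ℓ : ℕ} (hS : 1 ≤ S) (hU : 6 * (p + ℓ + 3) ≤ U) :
    Accurate (ℓ := ℓ) (Real.pi / S) (tableTc S p U ℓ) (2 / (2 : ℝ) ^ p) := by
  intro j y hj
  have hh : hiVal j y < 2 ^ j := hiVal_lt j hj y
  obtain ⟨hlo, hhi⟩ := abs_endpoints_le hj hh
  have e1 := abs_gaussF_sub_sGc_le (p := p) hS hU hlo
  have e2 := abs_gaussF_sub_sGc_le (p := p) hS hU hhi
  rw [cast_loZ] at e1
  rw [cast_hiZ] at e2
  unfold tableTc prefG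
  rw [Rat.cast_sub, abs_sub_comm]
  rw [show gaussF (Real.pi / S) (((hiVal j y * 2 ^ (ℓ - j) : ℕ) : ℝ) + 2 ^ (ℓ - j) - 2 ^ (ℓ - 1)) -
      gaussF (Real.pi / S) (((hiVal j y * 2 ^ (ℓ - j) : ℕ) : ℝ) - 2 ^ (ℓ - 1)) -
      ((sGc S p U (hiZ ℓ j (hiVal j y)) : ℝ) - (sGc S p U (loZ ℓ j (hiVal j y)) : ℝ)) =
      (gaussF (Real.pi / S) (((hiVal j y * 2 ^ (ℓ - j) : ℕ) : ℝ) + 2 ^ (ℓ - j) - 2 ^ (ℓ - 1)) - (sGc S p U (hiZ ℓ j (hiVal j y)) : ℝ)) -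
      (gaussF (Real.pi / S) (((hiVal j y * 2 ^ (ℓ - j) : ℕ) : ℝ) - 2 ^ (ℓ - 1)) - (sGc S p U (loZ ℓ j (hiVal j y)) : ℝ)) by ring]
  refine (abs_sub _ _).trans ?_
  rw [show (2 : ℝ) / 2 ^ p = 1 / 2 ^ p + 1 / 2 ^ p by ring]
  exact add_le_add e2 e1

end GRMassTable

end Literature.Computability.QuantumComplexity

end
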